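import Summits.QuantumFields.QCD.Theses.QuarksAsStableAction
import Summits.QuantumFields.QCD.Theorems.QuarksAsStableActionStableActionBridgeSylvesterDefect
import Summits.QuantumFields.QCD.Theorems.QuarksAsStableActionStableActionBridgeSupportedDeterminant
import Summits.QuantumFields.QCD.Theorems.QuarksAsStableActionStableActionBridgeDefectRowSum
import Summits.QuantumFields.QCD.Theorems.QuarksAsStableActionStableActionBridgeFreePropagatorBound

/-!
# The Sylvester-defect bound for the Wilson determinant: clause (i) of the smooth-patch lever
(crux `QuarksAsStableAction.StableActionBridge`, item stmt-QuantumFields-9737, line `Sketch`; lead helper of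
continuation lead c2, cycle 3, `--supports stmt-QuantumFields-9737`; card `sylvester-defect-floor` §Lever)

Assembly of four landed atoms of the line:

* the Sylvester / Weinstein–Aronszajn defect identity `det D[U] = det D[U′] · det(1 + χ (D − D′) D′⁻¹ χ)`
  (`det_wilsonDirac_eq_det_mul_det_defect`, p105792), `χ` the `0/1` projection onto the DEFECT SET
  `Z̄ = {quark indices whose site touches a link where U ≠ U′}`;
* the supported-determinant Hadamard bound `‖det(1 + K)‖ ≤ (1 + √|Z̄| κ)^{|Z̄|}` for `K` vanishing in the
  columns outside `Z̄` with entries `≤ κ` on `Z̄ × Z̄` (`norm_det_one_add_le_of_supported_of_entry_le`, p110766);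
* the row-sum bound `Σ_q ‖(D[U] − D[U′]) p q‖ ≤ 64 N` of the defect perturbation (`wilsonDirac_sub_rowSum_le`,
  p110712);
* the volume-uniform entry bound `‖D_AP[𝟙, m]⁻¹ p q‖ ≤ 153` of the FREE all-antiperiodic Wilson propagator for
  `m ≥ −1/2` (`free_ap_propagator_entry_bound` and its public pieces, p112759).

Results (pure finite-dimensional linear algebra on top of them, no definitions):

* `norm_det_wilsonDirac_le_of_inv_entry_le` — **clause (i) of the lever relative to an arbitrary patch**:
  for a unitary representation `ρ`, `L ≥ 2`, gauge fields `U, U′` with `det D[U′]` a unit and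
  `‖D[U′]⁻¹ p q‖ ≤ C` for all entries, `‖det D_W[U]‖ ≤ (1 + √|Z̄| · 64 N C)^{|Z̄|} · ‖det D_W[U′]‖` — the whole
  dependence on the rough links is carried by the patched propagator's entry bound, as the card's lever says;
* `free_ap_det_isUnit` — the free all-antiperiodic `SU(3)`/`U(3)` Wilson–Dirac operator (route seam convention)
  has non-vanishing determinant for every `m ≥ −1/2` and every `L ≥ 1`;
* `free_patch_defect_bound` — **the `j = 0` instance against the free patch**, in the route's own `apDet`
  vocabulary: for `L ≥ 2`, `m ∈ [−1/2, 1]` and every `SU(3)` field `U`,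
  `‖apDet U m‖ ≤ (1 + κ √|Z̄(U)|)^{|Z̄(U)|} · ‖apDet 𝟙 m‖` with `κ = 64·3·153` and
  `Z̄(U) = {p | some link (p.1, μ) or (p.1 − μ̂, μ) has U ≠ 1}` — a bare-scale, volume-uniform domination of the
  antiperiodic Wilson-quark determinant by the free one through the mass window around `κ = 1/8`, of the shape
  of `WilsonQuarkStability` with the defect-set size in place of the action functionals.

References: card `sylvester-defect-floor` (ideator 2) §Lever; B. Simon, *Trace Ideals and Their Applications*
(2nd ed., AMS 2005), Hadamard row bound; Montvay–Münster, *Quantum Fields on a Lattice* §4.2 (4.85).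
-/

namespace Summit.QuantumFields.QCD.Cruxes.StableActionBridge.Sketch

open Literature.MathematicalPhysics.QuantumLattice Literature.MathematicalPhysics.QuantumFieldTheory
open Literature.Probability.LatticeModels (TorusSite)

/-! ### Generic entry bookkeeping -/

section Generic

variable {n : Type*} [Fintype n] [DecidableEq n]

/-- Entries of a `0/1`-diagonal sandwich `χ A B χ` are bounded by those of `A B`. -/
theorem norm_diag01_mul_mul_mul_diag01_apply_le (P : n → Prop) [DecidablePred P] (A B : Matrix n n ℂ)
    (i j : n) :
    ‖(Matrix.diagonal (fun p => if P p then (1 : ℂ) else 0) * A * B *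
        Matrix.diagonal (fun p => if P p then (1 : ℂ) else 0)) i j‖ ≤ ‖(A * B) i j‖ := by
  rw [Matrix.mul_assoc (Matrix.diagonal _) A B, Matrix.mul_diagonal, Matrix.diagonal_mul, norm_mul, norm_mul]
  have h1 : ‖(if P i then (1 : ℂ) else 0)‖ ≤ 1 := by split_ifs <;> simp
  have h2 : ‖(if P j then (1 : ℂ) else 0)‖ ≤ 1 := by split_ifs <;> simp
  calc ‖(if P i then (1 : ℂ) else 0)‖ * ‖(A * B) i j‖ * ‖(if P j then (1 : ℂ) else 0)‖
      ≤ 1 * ‖(A * B) i j‖ * 1 :=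
        mul_le_mul (mul_le_mul_of_nonneg_right h1 (norm_nonneg _)) h2 (norm_nonneg _)
          (mul_nonneg zero_le_one (norm_nonneg _))
    _ = ‖(A * B) i j‖ := by ring

/-- A `0/1`-diagonal sandwich `χ A B χ` vanishes in the columns where `χ` does. -/
theorem diag01_mul_mul_mul_diag01_apply_of_not (P : n → Prop) [DecidablePred P] (A B : Matrix n n ℂ)
    (i j : n) (hj : ¬ P j) :
    (Matrix.diagonal (fun p => if P p then (1 : ℂ) else 0) * A * B *
        Matrix.diagonal (fun p => if P p then (1 : ℂ) else 0)) i j = 0 := by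
  rw [Matrix.mul_diagonal, if_neg hj, mul_zero]

omit [DecidableEq n] in
/-- Entries of a product against an entrywise-bounded matrix: `‖(V M) i j‖ ≤ (Σ_l ‖V i l‖) · C`. -/
theorem norm_mul_apply_le_rowSum_mul (V M : Matrix n n ℂ) {C : ℝ} (hM : ∀ p q, ‖M p q‖ ≤ C) (i j : n) :
    ‖(V * M) i j‖ ≤ (∑ l, ‖V i l‖) * C := by
  rw [Matrix.mul_apply, Finset.sum_mul]
  refine (norm_sum_le _ _).trans (Finset.sum_le_sum fun l _ => ?_)
  rw [norm_mul]
  exact mul_le_mul_of_nonneg_left (hM l j) (norm_nonneg _)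

end Generic

/-! ### Clause (i) of the lever relative to an arbitrary patch -/

open Classical in
/-- **Sylvester-defect bound relative to a patch** (clause (i) of the smooth-patch lever of card
`sylvester-defect-floor`; registered sub-goal `norm_det_wilsonDirac_le_of_inv_entry_le` of crux
stmt-QuantumFields-9737).  For a unitary representation `ρ`, a torus of side `L ≥ 2`, gauge fields `U, U′`, bare
mass `m`, `r = 1`: if `det D_W[U′]` is a unit and every entry of the patched propagator satisfies
`‖D_W[U′]⁻¹ p q‖ ≤ C` (`C ≥ 0`), then with the defect set
`Z̄ = {p | ∃ μ, U (p.1, μ) ≠ U′ (p.1, μ) ∨ ∃ μ, U (p.1 − μ̂, μ) ≠ U′ (p.1 − μ̂, μ)}`,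
`‖det D_W[U]‖ ≤ (1 + √|Z̄| · (64 N C))^{|Z̄|} · ‖det D_W[U′]‖`. -/
theorem norm_det_wilsonDirac_le_of_inv_entry_le :
    ∀ (N L : ℕ) [NeZero L] (G : Type) [Group G] (ρ : G →* Matrix (Fin N) (Fin N) ℂ),
      (∀ g, ρ g ∈ Matrix.unitaryGroup (Fin N) ℂ) → 2 ≤ L →
        ∀ (U U' : GaugeConfig 4 L G) (m C : ℝ), 0 ≤ C → IsUnit (wilsonDirac ρ U' m 1).det →
          (∀ p q, ‖(wilsonDirac ρ U' m 1)⁻¹ p q‖ ≤ C) →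
            ‖(wilsonDirac ρ U m 1).det‖ ≤
              (1 + Real.sqrt ((Finset.univ.filter fun p : TorusSite 4 L × Fin N × Fin 4 =>
                  (∃ μ : Fin 4, U (p.1, μ) ≠ U' (p.1, μ)) ∨
                    (∃ μ : Fin 4, U (p.1 - Pi.single μ 1, μ) ≠ U' (p.1 - Pi.single μ 1, μ))).card : ℝ) *
                  (64 * N * C)) ^
                (Finset.univ.filter fun p : TorusSite 4 L × Fin N × Fin 4 =>
                  (∃ μ : Fin 4, U (p.1, μ) ≠ U' (p.1, μ)) ∨
                    (∃ μ : Fin 4, U (p.1 - Pi.single μ 1, μ) ≠ U' (p.1 - Pi.single μ 1, μ))).card *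
              ‖(wilsonDirac ρ U' m 1).det‖ := by
  intro N L _ G _ ρ hρ hL U U' m C hC hdet hinv
  set P : TorusSite 4 L × Fin N × Fin 4 → Prop := fun p =>
    (∃ μ : Fin 4, U (p.1, μ) ≠ U' (p.1, μ)) ∨
      (∃ μ : Fin 4, U (p.1 - Pi.single μ 1, μ) ≠ U' (p.1 - Pi.single μ 1, μ)) with hP
  set D := wilsonDirac ρ U m 1 with hD
  set D' := wilsonDirac ρ U' m 1 with hD'
  set χ : Matrix (TorusSite 4 L × Fin N × Fin 4) (TorusSite 4 L × Fin N × Fin 4) ℂ :=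
    Matrix.diagonal fun p => if P p then (1 : ℂ) else 0 with hχ
  -- the Sylvester identity
  have hsyl : D.det = D'.det * (1 + χ * (D - D') * D'⁻¹ * χ).det := by
    have h := det_wilsonDirac_eq_det_mul_det_defect ρ U U' m 1
    exact h hdet
  -- the Sylvester factor: column support and entry bound
  set K := χ * (D - D') * D'⁻¹ * χ with hK
  have hcol : ∀ i j, ¬ P j → K i j = 0 := fun i j hj =>
    diag01_mul_mul_mul_diag01_apply_of_not P (D - D') D'⁻¹ i j hj
  have hent : ∀ i j, P i → P j → ‖K i j‖ ≤ 64 * N * C := by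
    intro i j _ _
    calc ‖K i j‖ ≤ ‖((D - D') * D'⁻¹) i j‖ := norm_diag01_mul_mul_mul_diag01_apply_le P (D - D') D'⁻¹ i j
      _ ≤ (∑ l, ‖(D - D') i l‖) * C := norm_mul_apply_le_rowSum_mul (D - D') D'⁻¹ hinv i j
      _ ≤ 64 * N * C :=
          mul_le_mul_of_nonneg_right (wilsonDirac_sub_rowSum_le N L G ρ hρ hL U U' m i) hC
  have hκ : (0 : ℝ) ≤ 64 * N * C := by positivity
  have hH := norm_det_one_add_le_of_supported_of_entry_le _ K P (64 * N * C) hκ hcol hent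
  rw [hsyl, norm_mul, mul_comm]
  exact mul_le_mul_of_nonneg_right hH (norm_nonneg _)

/-! ### The free antiperiodic patch -/

/-- **The free all-antiperiodic Wilson–Dirac operator is invertible for `m ≥ −1/2`**: with the route's seam
convention (trivial `U(3)` field sign-flipped on the links `e` with `e.1 e.2 = −1`), `det D_AP[𝟙, m]` is a unit
for every `L ≥ 1` (seam ↔ constant phase `e^{iπ/L}` by a gauge transformation, plane-wave diagonalisation,
positivity of the symbol `h(k)` from `stub_apLatticeSum`). -/
theorem free_ap_det_isUnit (L : ℕ) [NeZero L] (m : ℝ) (hm : -(1 / 2 : ℝ) ≤ m) :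
    IsUnit (wilsonDirac (unitaryFundamentalRep (Fin 3) ℂ)
      (fun e : Edge 4 L => if e.1 e.2 = -1 then (-1 : Matrix.unitaryGroup (Fin 3) ℂ) else 1) m 1).det := by
  set ω : Matrix.unitaryGroup (Fin 3) ℂ :=
    ⟨_, CriticalLineDiamagnetism.ChessboardCellGain.FreeDetFormula.phase_mem_unitaryGroup L⟩ with hωdef
  have hω : (ω : Matrix (Fin 3) (Fin 3) ℂ) =
      Complex.exp (↑(Real.pi / L) * Complex.I) • (1 : Matrix (Fin 3) (Fin 3) ℂ) := rfl
  rw [FreePropagatorBound.seam_eq_gaugeTransform_phase hω]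
  have hgauge := fermionDet_wilsonDirac_gaugeTransform (unitaryFundamentalRep (Fin 3) ℂ)
    (fun x : Site 4 L => ω ^ (∑ ν, (x ν).val)) (fun _ : Edge 4 L => ω) m 1
  change (wilsonDirac (unitaryFundamentalRep (Fin 3) ℂ)
      (gaugeTransform (fun x : Site 4 L => ω ^ (∑ ν, (x ν).val)) (fun _ : Edge 4 L => ω)) m 1).det =
    (wilsonDirac (unitaryFundamentalRep (Fin 3) ℂ) (fun _ : Edge 4 L => ω) m 1).det at hgauge
  rw [hgauge, isUnit_iff_ne_zero]
  obtain ⟨hpos, -⟩ := FreePropagatorBound.symbol_pos_and_sum_le L m hm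
  have hF := WilsonQuarkStability.FreeTangentLandauChessboard.stub_freeTwistedFourier L (Real.pi / L) m ω hω
  dsimp only at hF
  exact (hF hpos).1

/-- The antiperiodic `U(3)` lift of an `SU(3)` field differs from the lift of the trivial field exactly on the
links where the field is non-trivial. -/
theorem apLift_ne_apLift_one_iff {L : ℕ} (U : GaugeConfig 4 L (Matrix.specialUnitaryGroup (Fin 3) ℂ))
    (e : Edge 4 L) :
    ((if e.1 e.2 = -1 then
        -(⟨(U e).1, Matrix.specialUnitaryGroup_le_unitaryGroup (U e).2⟩ : Matrix.unitaryGroup (Fin 3) ℂ)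
      else ⟨(U e).1, Matrix.specialUnitaryGroup_le_unitaryGroup (U e).2⟩) ≠
      (if e.1 e.2 = -1 then
        -(⟨((1 : GaugeConfig 4 L (Matrix.specialUnitaryGroup (Fin 3) ℂ)) e).1,
            Matrix.specialUnitaryGroup_le_unitaryGroup
              ((1 : GaugeConfig 4 L (Matrix.specialUnitaryGroup (Fin 3) ℂ)) e).2⟩ :
            Matrix.unitaryGroup (Fin 3) ℂ)
      else ⟨((1 : GaugeConfig 4 L (Matrix.specialUnitaryGroup (Fin 3) ℂ)) e).1,
          Matrix.specialUnitaryGroup_le_unitaryGroup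
            ((1 : GaugeConfig 4 L (Matrix.specialUnitaryGroup (Fin 3) ℂ)) e).2⟩)) ↔
      U e ≠ 1 := by
  have key : ((⟨(U e).1, Matrix.specialUnitaryGroup_le_unitaryGroup (U e).2⟩ : Matrix.unitaryGroup (Fin 3) ℂ) =
      ⟨((1 : GaugeConfig 4 L (Matrix.specialUnitaryGroup (Fin 3) ℂ)) e).1,
        Matrix.specialUnitaryGroup_le_unitaryGroup
          ((1 : GaugeConfig 4 L (Matrix.specialUnitaryGroup (Fin 3) ℂ)) e).2⟩) ↔ U e = 1 := by
    rw [Subtype.ext_iff, Subtype.ext_iff]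
    rfl
  split_ifs with h
  · rw [not_iff_not, neg_inj, key]
  · rw [not_iff_not, key]

open Classical in
/-- **The `j = 0` instance of the lever: the antiperiodic Wilson-quark determinant against the free one**
(registered sub-goal `free_patch_defect_bound` of crux stmt-QuantumFields-9737; card `sylvester-defect-floor`,
"the `j = 0`, patch-to-𝟙 instance of the lever").  In the route's vocabulary (`apDet` exactly as in
`WilsonQuarkStability` / `UnquenchedChessboardBound`): there is `κ ≥ 0` such that for every `L ≥ 2`, every bare
mass `m ∈ [−1/2, 1]` and every `SU(3)` gauge field `U` on `(ℤ/L)⁴`,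
`‖apDet U m‖ ≤ (1 + κ √|Z̄(U)|)^{|Z̄(U)|} · ‖apDet 𝟙 m‖`, where
`Z̄(U) = {p | ∃ μ, U (p.1, μ) ≠ 1 ∨ ∃ μ, U (p.1 − μ̂, μ) ≠ 1}` is the set of quark indices whose site touches a
non-trivial link.  Uniform in the volume; `κ = 64 · 3 · 153`. -/
theorem free_patch_defect_bound :
    ∃ κ : ℝ, 0 ≤ κ ∧ ∀ (L : ℕ) [NeZero L], 2 ≤ L → ∀ m : ℝ, -(1 / 2 : ℝ) ≤ m → m ≤ 1 →
      ∀ U : GaugeConfig 4 L (Matrix.specialUnitaryGroup (Fin 3) ℂ),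
        let apDet : GaugeConfig 4 L (Matrix.specialUnitaryGroup (Fin 3) ℂ) → ℝ → ℂ := fun U m =>
          fermionDet (wilsonDirac (unitaryFundamentalRep (Fin 3) ℂ)
            (fun e => if e.1 e.2 = -1
              then -(⟨(U e).1, Matrix.specialUnitaryGroup_le_unitaryGroup (U e).2⟩ :
                Matrix.unitaryGroup (Fin 3) ℂ)
              else ⟨(U e).1, Matrix.specialUnitaryGroup_le_unitaryGroup (U e).2⟩) m 1)
        let Z : Finset (TorusSite 4 L × Fin 3 × Fin 4) := Finset.univ.filter fun p =>
          (∃ μ : Fin 4, U (p.1, μ) ≠ 1) ∨ (∃ μ : Fin 4, U (p.1 - Pi.single μ 1, μ) ≠ 1)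
        ‖apDet U m‖ ≤ (1 + κ * Real.sqrt (Z.card : ℝ)) ^ Z.card * ‖apDet 1 m‖ := by
  obtain ⟨C, hC⟩ := free_ap_propagator_entry_bound
  -- `C ≥ 0` may be assumed (the bound at `L = 1`, `m = 0` is an instance of a norm bound)
  have hC0 : 0 ≤ C := by
    haveI : NeZero (1 : ℕ) := ⟨one_ne_zero⟩
    have h := hC 1 0 (by norm_num) (by norm_num) ((0 : TorusSite 4 1), 0, 0) ((0 : TorusSite 4 1), 0, 0)
    exact (norm_nonneg _).trans h
  refine ⟨64 * 3 * C, by positivity, ?_⟩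
  intro L _ hL m hm0 hm1 U apDet Z
  -- the lifted fields
  set V : GaugeConfig 4 L (Matrix.unitaryGroup (Fin 3) ℂ) := fun e => if e.1 e.2 = -1
      then -(⟨(U e).1, Matrix.specialUnitaryGroup_le_unitaryGroup (U e).2⟩ : Matrix.unitaryGroup (Fin 3) ℂ)
      else ⟨(U e).1, Matrix.specialUnitaryGroup_le_unitaryGroup (U e).2⟩ with hV
  set V1 : GaugeConfig 4 L (Matrix.unitaryGroup (Fin 3) ℂ) := fun e => if e.1 e.2 = -1
      then -(⟨((1 : GaugeConfig 4 L (Matrix.specialUnitaryGroup (Fin 3) ℂ)) e).1,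
          Matrix.specialUnitaryGroup_le_unitaryGroup
            ((1 : GaugeConfig 4 L (Matrix.specialUnitaryGroup (Fin 3) ℂ)) e).2⟩ : Matrix.unitaryGroup (Fin 3) ℂ)
      else ⟨((1 : GaugeConfig 4 L (Matrix.specialUnitaryGroup (Fin 3) ℂ)) e).1,
          Matrix.specialUnitaryGroup_le_unitaryGroup
            ((1 : GaugeConfig 4 L (Matrix.specialUnitaryGroup (Fin 3) ℂ)) e).2⟩ with hV1
  have hV1' : V1 = fun e : Edge 4 L => if e.1 e.2 = -1 then (-1 : Matrix.unitaryGroup (Fin 3) ℂ) else 1 := by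
    funext e
    simp only [hV1]
    rfl
  -- invertibility and entry bound of the free patch
  have hunit : IsUnit (wilsonDirac (unitaryFundamentalRep (Fin 3) ℂ) V1 m 1).det := by
    rw [hV1']; exact free_ap_det_isUnit L m hm0
  have hinv : ∀ p q, ‖(wilsonDirac (unitaryFundamentalRep (Fin 3) ℂ) V1 m 1)⁻¹ p q‖ ≤ C := by
    rw [hV1']; exact hC L m hm0 hm1
  -- clause (i) relative to the free patch
  have hmain := norm_det_wilsonDirac_le_of_inv_entry_le 3 L (Matrix.unitaryGroup (Fin 3) ℂ)
    (unitaryFundamentalRep (Fin 3) ℂ) unitaryFundamentalRep_mem_unitaryGroup hL V V1 m C hC0 hunit hinv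
  -- transport along the identification of the lifts' defect set with `Z`
  obtain ⟨W, hW, hWZ⟩ : ∃ W : Finset (TorusSite 4 L × Fin 3 × Fin 4),
      ‖(wilsonDirac (unitaryFundamentalRep (Fin 3) ℂ) V m 1).det‖ ≤
          (1 + Real.sqrt (W.card : ℝ) * (64 * ((3 : ℕ) : ℝ) * C)) ^ W.card *
            ‖(wilsonDirac (unitaryFundamentalRep (Fin 3) ℂ) V1 m 1).det‖ ∧ W = Z :=
    ⟨_, hmain, by
      -- the defect set of the lifted fields `V, V1` coincides with `Z`
      ext p
      simp only [Finset.mem_filter, Finset.mem_univ, true_and, Z, hV, hV1]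
      exact or_congr (exists_congr fun μ => apLift_ne_apLift_one_iff U (p.1, μ))
        (exists_congr fun μ => apLift_ne_apLift_one_iff U (p.1 - Pi.single μ 1, μ))⟩
  change ‖(wilsonDirac (unitaryFundamentalRep (Fin 3) ℂ) V m 1).det‖ ≤
    (1 + 64 * 3 * C * Real.sqrt (Z.card : ℝ)) ^ Z.card *
      ‖(wilsonDirac (unitaryFundamentalRep (Fin 3) ℂ) V1 m 1).det‖
  rw [← hWZ]
  calc ‖(wilsonDirac (unitaryFundamentalRep (Fin 3) ℂ) V m 1).det‖
      ≤ (1 + Real.sqrt (W.card : ℝ) * (64 * ((3 : ℕ) : ℝ) * C)) ^ W.card *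
          ‖(wilsonDirac (unitaryFundamentalRep (Fin 3) ℂ) V1 m 1).det‖ := hW
    _ = (1 + 64 * 3 * C * Real.sqrt (W.card : ℝ)) ^ W.card *
          ‖(wilsonDirac (unitaryFundamentalRep (Fin 3) ℂ) V1 m 1).det‖ := by
        rw [Nat.cast_ofNat, mul_comm (Real.sqrt _)]

end Summit.QuantumFields.QCD.Cruxes.StableActionBridge.Sketch
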